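import Literature.MathematicalPhysics.QuantumLattice.HubbardTTPrimeChemicalPotentialFloors
import HarnessLib

/-!
# The grand-canonical coordinate, II: density and chemical-potential brackets, the `(t', U, μ)`
# supergradient plane, monotonicity of the conjugate map, and the covering rule for parameter boxes

Family `hubbard` (topic `MathematicalPhysics/QuantumLattice`); continuation of
`HubbardTTPrimeChemicalPotentialFloors` (the `μ`-floors `c + μ m ≤ e(t,t',U,m)`, their joint transport
in `(t', U, μ)` and their completeness), written for stage S2 of the Hubbard material oracle (seat
`hubbard-box-p1`). `e(t,t',U,n) = energyDensityTT' t t' U n`; for a state `ω` on `ℤ²`,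
`e^{t,t',U}(ω) = ω.meanEnergy (hubbardTTPrimeFermionInteraction t t' U) 1`, `ρ(ω) = ω.density`,
`D(ω) = e^{0,0,1}(ω)` (the double-occupancy density of torus limits) and `A(ω) = e^{0,1,0}(ω)` (the unit
diagonal-hopping energy per site). A state, or a pair `(E, ρ)`, is **grand-canonically minimal at `μ`**
when `E − μ ρ ≤ e(t,t',U,m) − μ m` for the densities `m` in question — every torus-limit ground state is,
at any supporting slope of `e(·)` at its density (`IsTorusLimitOf.exists_chemicalPotential`).

* §4 BRACKETS (Griffiths' inequalities with certified data). The density of a grand-canonically minimal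
  state at `μ` is bracketed by any `μ'`-floor at a NEIGHBOURING chemical potential and one energy ceiling:
  `μ < μ'`, floor `(c', μ')`, ceiling `e(m₀) ≤ R₀` ⇒ `ρ ≤ (R₀ − μ m₀ − c')/(μ' − μ)`; `μ' < μ` ⇒
  `(c' + μ m₀ − R₀)/(μ − μ') ≤ ρ` (`density_le_of_gcMinimal`, `le_density_of_gcMinimal`, state forms
  `IsTranslationInvariant.density_le_…` / `….le_density_…`) — the map `(U, t', μ)`-cell ↦ density interval.
  Conversely the chemical potentials of a density `n` are bracketed by secants of the certified energy table
  (`chemicalPotential_le_secant`, `secant_le_chemicalPotential`) — the map density interval ↦ `μ`-interval,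
  which decides which `(U, t', μ)`-cells a material box in `(U, t', n)` needs.
* §5 THE `(t', U, μ)` SUPERGRADIENT PLANE ("two-parameter tangent-plane lemma", grand-canonical form):
  for a torus-limit ground state `ω` at `(t'₀, U₀)` of density `n₀`,
  `e(t,t',U,n₀) − μ n₀ ≤ (e(t,t'₀,U₀,n₀) − μ₀ n₀) + (U − U₀) D(ω) + (t' − t'₀) A(ω) − (μ − μ₀) n₀` for all
  `t'`, `U ≥ 0`, `μ, μ₀` (`IsTorusLimitOf.gcEnergy_le_affine`): the grand-canonical energy
  `inf_m (e(t',U,m) − μ m)`, jointly concave in `(t', U, μ)`, lies below its tangent hyperplane at the anchor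
  with gradient `(A(ω), D(ω), −n₀)` — a `μ`-CEILING over a whole `(t', U, μ)`-region from one anchor.
* §6 MONOTONE CONJUGATE MAP: for any two states with the two cross grand-canonical inequalities at
  `(t'_A, U_A, μ_A)` and `(t'_P, U_P, μ_P)`,
  `(U_P − U_A)(D_P − D_A) + (t'_P − t'_A)(A_P − A_A) − (μ_P − μ_A)(ρ_P − ρ_A) ≤ 0`
  (`directionalGC_le_of_cross_variational`; the `μ`-less case is the tree's
  `directional_le_of_cross_variational`): the density is non-decreasing in `μ` (`density_mono_of_…`), and
  along a line of CONSTANT CHEMICAL POTENTIAL the double occupancy is non-increasing in `U` although the two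
  densities differ (`docc_anti_U_at_mu_of_…`); torus-limit ground-state form
  `IsTorusLimitOf.directionalGC_le_of_groundStates`.
* §7 COVERING RULE ("box ⊂ union of certified cells ⇒ one word"): a bound certified cell by cell holds on
  every set the cells cover, with the worst cell constant (`le_sup'_of_cover`, `inf'_le_of_cover`,
  `mem_Icc_of_cover`); for energies over a product box `R × [n₁, n₂]` covered by `(t', U)`-cells each
  carrying a cell-wide `μ`-floor, the floor of the box is the least corner value
  `min (c_k + μ_k n₁) (c_k + μ_k n₂)` over the cells (`energyDensityTT'_ge_inf'_of_gcFloor_cover`).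

Everything is PROVED; no definition, no named fact, no numerical input. Not here: the Legendre object
`inf_m (e − μ m)` as a definition with its `ConcaveOn` statement (a definition file), `T > 0`, and
observables other than the conjugate triple `(D, A, ρ)` (two-body words travel by the window-certificate
combination `HubbardTTPrimeWindowCertificateConvexComb`).

## References

* R. B. Griffiths, Phys. Rev. 152 (1966) 240, §II–III (one-sided derivatives of the concave ground-state
  energy bound the conjugate observable in every ground state; monotonicity). [cite: Griffiths1966, §II]
* D. Ruelle, *Statistical Mechanics: Rigorous Results* (1969), §3.4 (density versus chemical potential;
  canonical/grand-canonical equivalence). [cite: Ruelle1969, §3.4]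
* T. Koma, H. Tasaki, J. Stat. Phys. 76 (1994) 745, §1 (supergradient inequality for a coupling
  multiplying a term of the Hamiltonian). [cite: KomaTasaki1994, §1]
* R. B. Israel, *Convexity in the Theory of Lattice Gases* (1979), Thm. I.3.4. [cite: Israel1979, Thm. I.3.4]
-/

noncomputable section

namespace Literature.MathematicalPhysics.QuantumLattice

open Matrix Finset HubbardWave0 Literature.Probability.LatticeModels ThermodynamicLimit
open _root_.Filter
open scoped _root_.Topology ComplexOrder BigOperators

/-! ### §4 Density brackets and chemical-potential brackets from certified data -/

namespace ThermodynamicLimit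

/-- **Upper density bracket (Griffiths).** Let `(E, ρ)` be grand-canonically minimal at `μ` against the
density `m₀` — `E − μ ρ ≤ e(m₀) − μ m₀` — with `e(ρ) ≤ E` (e.g. `E = e^{tt'}(ω)`, `ρ = ρ(ω)` for a
translation-invariant `ω`), let `e(m₀) ≤ R₀` be a certified ceiling and `(c', μ')` a `μ'`-floor at a LARGER
chemical potential `μ' > μ`, read at `ρ`: `c' + μ' ρ ≤ e(ρ)`. Then `ρ ≤ (R₀ − μ m₀ − c')/(μ' − μ)` (with exact
data this is `ρ ≤ (p(μ) − p(μ'))/(μ' − μ)`, `p` the grand-canonical energy). [cite: Griffiths1966, §II] -/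
theorem density_le_of_gcMinimal {t t' U E ρ μ μ' c' m₀ R₀ : ℝ}
    (hE : energyDensityTT' t t' U ρ ≤ E)
    (hgc : E - μ * ρ ≤ energyDensityTT' t t' U m₀ - μ * m₀)
    (hR₀ : energyDensityTT' t t' U m₀ ≤ R₀) (hc' : c' + μ' * ρ ≤ energyDensityTT' t t' U ρ)
    (hμ : μ < μ') : ρ ≤ (R₀ - μ * m₀ - c') / (μ' - μ) := by
  rw [le_div_iff₀ (sub_pos.2 hμ)]
  linarith

/-- **Lower density bracket (Griffiths)**: same data with the floor at a SMALLER chemical potential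
`μ' < μ` gives `(c' + μ m₀ − R₀)/(μ − μ') ≤ ρ`. [cite: Griffiths1966, §II] -/
theorem le_density_of_gcMinimal {t t' U E ρ μ μ' c' m₀ R₀ : ℝ}
    (hE : energyDensityTT' t t' U ρ ≤ E)
    (hgc : E - μ * ρ ≤ energyDensityTT' t t' U m₀ - μ * m₀)
    (hR₀ : energyDensityTT' t t' U m₀ ≤ R₀) (hc' : c' + μ' * ρ ≤ energyDensityTT' t t' U ρ)
    (hμ : μ' < μ) : (c' + μ * m₀ - R₀) / (μ - μ') ≤ ρ := by
  rw [div_le_iff₀ (sub_pos.2 hμ)]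
  linarith

/-- **Upper chemical-potential bracket by a secant.** If `μ` is a chemical potential of the density `n`
— `e(n) − μ n ≤ e(m) − μ m` for all `0 ≤ m < 2` — then for every larger density `n < m₁ < 2` with a
certified ceiling `e(m₁) ≤ R₁` and a certified floor `L ≤ e(n)`: `μ ≤ (R₁ − L)/(m₁ − n)` (a supporting slope
of a convex function is below every secant to the right). [cite: Ruelle1969, §3.4] -/
theorem chemicalPotential_le_secant {t t' U n μ m₁ R₁ L : ℝ}
    (hμ : ∀ m : ℝ, 0 ≤ m → m < 2 → energyDensityTT' t t' U n - μ * n ≤ energyDensityTT' t t' U m - μ * m)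
    (hm₁0 : 0 ≤ m₁) (hm₁2 : m₁ < 2) (hnm : n < m₁) (hR₁ : energyDensityTT' t t' U m₁ ≤ R₁)
    (hL : L ≤ energyDensityTT' t t' U n) : μ ≤ (R₁ - L) / (m₁ - n) := by
  have h := hμ m₁ hm₁0 hm₁2
  rw [le_div_iff₀ (sub_pos.2 hnm)]
  linarith

/-- **Lower chemical-potential bracket by a secant**: for a smaller density `0 ≤ m₁ < n` with
`e(m₁) ≤ R₁` and `L ≤ e(n)`: `(L − R₁)/(n − m₁) ≤ μ`. Together with `chemicalPotential_le_secant`: the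
chemical potentials of a material of known filling lie in a certified interval read off the energy table —
which `(U, t', μ)`-cells a box in `(U, t', n)` must be covered by. [cite: Ruelle1969, §3.4] -/
theorem secant_le_chemicalPotential {t t' U n μ m₁ R₁ L : ℝ}
    (hμ : ∀ m : ℝ, 0 ≤ m → m < 2 → energyDensityTT' t t' U n - μ * n ≤ energyDensityTT' t t' U m - μ * m)
    (hm₁0 : 0 ≤ m₁) (hm₁2 : m₁ < 2) (hmn : m₁ < n) (hR₁ : energyDensityTT' t t' U m₁ ≤ R₁)
    (hL : L ≤ energyDensityTT' t t' U n) : (L - R₁) / (n - m₁) ≤ μ := by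
  have h := hμ m₁ hm₁0 hm₁2
  rw [div_le_iff₀ (sub_pos.2 hmn)]
  linarith

end ThermodynamicLimit

namespace InfVolFermionState

/-- **Upper density bracket for grand-canonically minimal translation-invariant states.** For `U ≥ 0`,
a translation-invariant `ω` on `ℤ²` with `ρ(ω) ∈ (0,2)` and
`e^{tt'}(ω) − μ ρ(ω) ≤ e(t,t',U,m₀) − μ m₀` (grand-canonical minimality at `μ`, tested at `m₀`), a ceiling
`e(m₀) ≤ R₀` and a `μ'`-floor `(c', μ')` with `μ' > μ`: `ρ(ω) ≤ (R₀ − μ m₀ − c')/(μ' − μ)`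
(`e(ρ(ω)) ≤ e^{tt'}(ω)` by the variational principle). [cite: Griffiths1966, §II] -/
theorem IsTranslationInvariant.density_le_of_gcMinimal {ω : InfVolFermionState 2}
    (hω : ω.IsTranslationInvariant) (t t' : ℝ) {U : ℝ} (hU : 0 ≤ U) (hρ0 : 0 < ω.density)
    (hρ2 : ω.density < 2) {μ μ' c' m₀ R₀ : ℝ}
    (hgc : ω.meanEnergy (hubbardTTPrimeFermionInteraction t t' U) 1 - μ * ω.density ≤
      energyDensityTT' t t' U m₀ - μ * m₀)
    (hR₀ : energyDensityTT' t t' U m₀ ≤ R₀)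
    (hc' : ∀ m : ℝ, 0 ≤ m → m < 2 → c' + μ' * m ≤ energyDensityTT' t t' U m) (hμ : μ < μ') :
    ω.density ≤ (R₀ - μ * m₀ - c') / (μ' - μ) :=
  ThermodynamicLimit.density_le_of_gcMinimal (hω.energyDensityTT'_le_meanEnergy t t' hU hρ0 hρ2) hgc hR₀
    (hc' ω.density hρ0.le hρ2) hμ

/-- **Lower density bracket for grand-canonically minimal translation-invariant states**: same data with
`μ' < μ` gives `(c' + μ m₀ − R₀)/(μ − μ') ≤ ρ(ω)`. [cite: Griffiths1966, §II] -/
theorem IsTranslationInvariant.le_density_of_gcMinimal {ω : InfVolFermionState 2}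
    (hω : ω.IsTranslationInvariant) (t t' : ℝ) {U : ℝ} (hU : 0 ≤ U) (hρ0 : 0 < ω.density)
    (hρ2 : ω.density < 2) {μ μ' c' m₀ R₀ : ℝ}
    (hgc : ω.meanEnergy (hubbardTTPrimeFermionInteraction t t' U) 1 - μ * ω.density ≤
      energyDensityTT' t t' U m₀ - μ * m₀)
    (hR₀ : energyDensityTT' t t' U m₀ ≤ R₀)
    (hc' : ∀ m : ℝ, 0 ≤ m → m < 2 → c' + μ' * m ≤ energyDensityTT' t t' U m) (hμ : μ' < μ) :
    (c' + μ * m₀ - R₀) / (μ - μ') ≤ ω.density :=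
  ThermodynamicLimit.le_density_of_gcMinimal (hω.energyDensityTT'_le_meanEnergy t t' hU hρ0 hρ2) hgc hR₀
    (hc' ω.density hρ0.le hρ2) hμ

/-! ### §5 The `(t', U, μ)` supergradient plane of a torus-limit ground state -/

/-- **The grand-canonical tangent hyperplane.** Let `ω` be a torus limit along `Ls → ∞` of unit ground
states of `hubbardTorusTT' (Ls j) t t'₀ U₀` in the sectors `(rectN n₀ (Ls j), S^z = 0)` (`U₀ ≥ 0`,
`0 ≤ n₀ < 2`). Then for every `t'`, every `U ≥ 0` and all `μ₀, μ`:
`e(t,t',U,n₀) − μ n₀ ≤ (e(t,t'₀,U₀,n₀) − μ₀ n₀) + (U − U₀)·D(ω) + (t' − t'₀)·A(ω) − (μ − μ₀)·n₀` — the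
grand-canonical energy `inf_m (e(t,t',U,m) − μ m)` (below the left side) lies under the hyperplane through
the anchor value with the three slopes `D(ω)` (conjugate to `U`), `A(ω)` (to `t'`) and `−n₀` (to `μ`); when
`μ₀` is a chemical potential of `n₀` the constant is the anchor's grand-canonical energy. The `(t', U)` part
is `IsTorusLimitOf.energyDensityTT'_le_affine`. [cite: KomaTasaki1994, §1] -/
theorem IsTorusLimitOf.gcEnergy_le_affine (t t'₀ : ℝ) {U₀ : ℝ} (hU₀ : 0 ≤ U₀) {n₀ : ℝ}
    (hn0 : 0 ≤ n₀) (hn2 : n₀ < 2)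
    {ω : InfVolFermionState 2} {ψ : ∀ L, Fock (Orb (FermionTorus 2 L))} {Ls : ℕ → ℕ}
    (h : ω.IsTorusLimitOf ψ Ls) (hLs : Tendsto Ls atTop atTop)
    (hψ : ∀ j, IsGroundStateInSector (hubbardTorusTT' (Ls j) t t'₀ U₀) (rectN n₀ (Ls j)) 0 (ψ (Ls j)))
    (h1 : ∀ j, star (ψ (Ls j)) ⬝ᵥ ψ (Ls j) = 1) (t' : ℝ) {U : ℝ} (hU : 0 ≤ U) (μ₀ μ : ℝ) :
    energyDensityTT' t t' U n₀ - μ * n₀ ≤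
      (energyDensityTT' t t'₀ U₀ n₀ - μ₀ * n₀) +
        (U - U₀) * ω.meanEnergy (hubbardTTPrimeFermionInteraction 0 0 1) 1 +
          (t' - t'₀) * ω.meanEnergy (hubbardTTPrimeFermionInteraction 0 1 0) 1 - (μ - μ₀) * n₀ := by
  have hb := h.energyDensityTT'_le_affine t t'₀ hU₀ hn0 hn2 hLs hψ h1 t' hU
  linarith

/-- **The `μ`-direction alone** (trivial but the shape the cell products quote): for every density `n₀`
with a ceiling `e(t,t',U,n₀) ≤ R` and all `μ`, the grand-canonical energy at `μ` is at most `R − μ n₀`, i.e.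
`e(t,t',U,n₀) − μ n₀ ≤ R − μ n₀`; across two chemical potentials the ceiling moves with slope `−n₀`.
[cite: Ruelle1969, §3.4] -/
theorem gcCeiling_of_ceiling {t t' U n₀ R : ℝ} (hR : energyDensityTT' t t' U n₀ ≤ R) (μ₀ μ : ℝ) :
    energyDensityTT' t t' U n₀ - μ * n₀ ≤ (R - μ₀ * n₀) - (μ - μ₀) * n₀ := by
  linarith

/-! ### §6 The conjugate map `(U, t', μ) ↦ (D, A, −ρ)` is monotone -/

/-- **Cross-variational monotonicity in `(U, t', μ)`.** For any two states `ωP, ωA` on `ℤ²` and reals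
`ρP, ρA` (their densities, or any reals for which the hypotheses hold) satisfying the two CROSS
grand-canonical inequalities — `P` is minimal at `(t'_P, U_P, μ_P)` against `A`, and `A` at
`(t'_A, U_A, μ_A)` against `P` — one has
`(U_P − U_A)(D(ωP) − D(ωA)) + (t'_P − t'_A)(A(ωP) − A(ωA)) − (μ_P − μ_A)(ρP − ρA) ≤ 0`
(add the two inequalities and use that the mean energy is affine in the couplings,
`meanEnergy_hubbardTTPrime_affine`): the supergradient map of the concave grand-canonical energy is
monotone. The `μ`-less case is `directional_le_of_cross_variational`. [cite: Griffiths1966, §II] -/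
theorem directionalGC_le_of_cross_variational (ωP ωA : InfVolFermionState 2)
    (t t'A UA μA t'P UP μP ρP ρA : ℝ)
    (hP : ωP.meanEnergy (hubbardTTPrimeFermionInteraction t t'P UP) 1 - μP * ρP ≤
      ωA.meanEnergy (hubbardTTPrimeFermionInteraction t t'P UP) 1 - μP * ρA)
    (hA : ωA.meanEnergy (hubbardTTPrimeFermionInteraction t t'A UA) 1 - μA * ρA ≤
      ωP.meanEnergy (hubbardTTPrimeFermionInteraction t t'A UA) 1 - μA * ρP) :
    (UP - UA) * (ωP.meanEnergy (hubbardTTPrimeFermionInteraction 0 0 1) 1 -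
        ωA.meanEnergy (hubbardTTPrimeFermionInteraction 0 0 1) 1) +
      (t'P - t'A) * (ωP.meanEnergy (hubbardTTPrimeFermionInteraction 0 1 0) 1 -
        ωA.meanEnergy (hubbardTTPrimeFermionInteraction 0 1 0) 1) -
      (μP - μA) * (ρP - ρA) ≤ 0 := by
  have hP' := ωP.meanEnergy_hubbardTTPrime_affine t t'A UA t'P UP
  have hA' := ωA.meanEnergy_hubbardTTPrime_affine t t'A UA t'P UP
  rw [hP', hA'] at hP
  nlinarith [hP, hA]

/-- **The density is non-decreasing in the chemical potential** (same `t'`, `U`): cross-minimal pairs at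
`μ_A < μ_P` have `ρA ≤ ρP`. [cite: Griffiths1966, §II] -/
theorem density_mono_of_cross_variational (ωP ωA : InfVolFermionState 2) {t t' U μA μP : ℝ} (ρP ρA : ℝ)
    (hμ : μA < μP)
    (hP : ωP.meanEnergy (hubbardTTPrimeFermionInteraction t t' U) 1 - μP * ρP ≤
      ωA.meanEnergy (hubbardTTPrimeFermionInteraction t t' U) 1 - μP * ρA)
    (hA : ωA.meanEnergy (hubbardTTPrimeFermionInteraction t t' U) 1 - μA * ρA ≤
      ωP.meanEnergy (hubbardTTPrimeFermionInteraction t t' U) 1 - μA * ρP) :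
    ρA ≤ ρP := by
  have h := directionalGC_le_of_cross_variational ωP ωA t t' U μA t' U μP ρP ρA hP hA
  rw [sub_self, sub_self, zero_mul, zero_mul, zero_add, zero_sub, neg_nonpos] at h
  nlinarith

/-- **Along a line of constant chemical potential the double occupancy is non-increasing in `U`** (same
`t'`, `μ`; the two densities may differ): cross-minimal pairs at `U_A < U_P` have `D(ωP) ≤ D(ωA)` —
concavity of the grand-canonical energy in `U`. [cite: Griffiths1966, §II] -/
theorem docc_anti_U_at_mu_of_cross_variational (ωP ωA : InfVolFermionState 2) {t t' UA UP μ : ℝ}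
    (ρP ρA : ℝ) (hUAP : UA < UP)
    (hP : ωP.meanEnergy (hubbardTTPrimeFermionInteraction t t' UP) 1 - μ * ρP ≤
      ωA.meanEnergy (hubbardTTPrimeFermionInteraction t t' UP) 1 - μ * ρA)
    (hA : ωA.meanEnergy (hubbardTTPrimeFermionInteraction t t' UA) 1 - μ * ρA ≤
      ωP.meanEnergy (hubbardTTPrimeFermionInteraction t t' UA) 1 - μ * ρP) :
    ωP.meanEnergy (hubbardTTPrimeFermionInteraction 0 0 1) 1 ≤
      ωA.meanEnergy (hubbardTTPrimeFermionInteraction 0 0 1) 1 := by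
  have h := directionalGC_le_of_cross_variational ωP ωA t t' UA μ t' UP μ ρP ρA hP hA
  rw [sub_self, sub_self, zero_mul, zero_mul, add_zero, sub_zero] at h
  nlinarith

/-- **Torus-limit ground states, grand-canonical directional inequality.** Let `ωA`, `ωP` be torus
limits (along `LsA, LsP → ∞`) of unit sector ground states of `hubbardTorusTT' · t t'_A U_A` at density
`n_A` and of `hubbardTorusTT' · t t'_P U_P` at density `n_P` (`U_A, U_P ≥ 0`, densities in `(0,2)`), and
let `μ_A`, `μ_P` be chemical potentials of `n_A` at `A` and of `n_P` at `P`
(`e(A,n_A) − μ_A n_A ≤ e(A,m) − μ_A m` for all `m`, likewise at `P`; they exist,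
`exists_chemicalPotential_energyDensityTT'`). Then
`(U_P − U_A)(D_P − D_A) + (t'_P − t'_A)(A_P − A_A) − (μ_P − μ_A)(n_P − n_A) ≤ 0` — the two cross
inequalities hold by the energy identity at the own coupling and the variational inequality at the other
(`IsTorusLimitOf.meanEnergy_hubbardTTPrime_eq_energyDensityTT'`,
`IsTorusLimitOf.energyDensityTT'_le_meanEnergy_hubbardTTPrime`). [cite: Griffiths1966, §II] -/
theorem IsTorusLimitOf.directionalGC_le_of_groundStates (t : ℝ) {t'A UA t'P UP μA μP nA nP : ℝ}
    (hUA : 0 ≤ UA) (hUP : 0 ≤ UP) (hnA0 : 0 < nA) (hnA2 : nA < 2) (hnP0 : 0 < nP) (hnP2 : nP < 2)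
    {ωA ωP : InfVolFermionState 2} {ψA ψP : ∀ L, Fock (Orb (FermionTorus 2 L))} {LsA LsP : ℕ → ℕ}
    (hA : ωA.IsTorusLimitOf ψA LsA) (hLsA : Tendsto LsA atTop atTop)
    (hψA : ∀ j, IsGroundStateInSector (hubbardTorusTT' (LsA j) t t'A UA) (rectN nA (LsA j)) 0 (ψA (LsA j)))
    (h1A : ∀ j, star (ψA (LsA j)) ⬝ᵥ ψA (LsA j) = 1)
    (hP : ωP.IsTorusLimitOf ψP LsP) (hLsP : Tendsto LsP atTop atTop)
    (hψP : ∀ j, IsGroundStateInSector (hubbardTorusTT' (LsP j) t t'P UP) (rectN nP (LsP j)) 0 (ψP (LsP j)))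
    (h1P : ∀ j, star (ψP (LsP j)) ⬝ᵥ ψP (LsP j) = 1)
    (hμA : ∀ m : ℝ, 0 ≤ m → m < 2 →
      energyDensityTT' t t'A UA nA - μA * nA ≤ energyDensityTT' t t'A UA m - μA * m)
    (hμP : ∀ m : ℝ, 0 ≤ m → m < 2 →
      energyDensityTT' t t'P UP nP - μP * nP ≤ energyDensityTT' t t'P UP m - μP * m) :
    (UP - UA) * (ωP.meanEnergy (hubbardTTPrimeFermionInteraction 0 0 1) 1 -
        ωA.meanEnergy (hubbardTTPrimeFermionInteraction 0 0 1) 1) +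
      (t'P - t'A) * (ωP.meanEnergy (hubbardTTPrimeFermionInteraction 0 1 0) 1 -
        ωA.meanEnergy (hubbardTTPrimeFermionInteraction 0 1 0) 1) -
      (μP - μA) * (nP - nA) ≤ 0 := by
  have hNA : ∀ j, IsNParticle (rectN nA (LsA j)) (ψA (LsA j)) := fun j =>
    ((mem_szSector_iff _ _ _).1 (hψA j).1).1
  have hNP : ∀ j, IsNParticle (rectN nP (LsP j)) (ψP (LsP j)) := fun j =>
    ((mem_szSector_iff _ _ _).1 (hψP j).1).1
  -- own couplings: energy identities
  have eA := hA.meanEnergy_hubbardTTPrime_eq_energyDensityTT' t t'A hUA hnA0.le hnA2 hLsA hψA h1A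
  have eP := hP.meanEnergy_hubbardTTPrime_eq_energyDensityTT' t t'P hUP hnP0.le hnP2 hLsP hψP h1P
  -- cross couplings: variational inequalities
  have vA := hP.energyDensityTT'_le_meanEnergy_hubbardTTPrime t t'A hUA hnP0.le hnP2 hLsP hNP h1P
  have vP := hA.energyDensityTT'_le_meanEnergy_hubbardTTPrime t t'P hUP hnA0.le hnA2 hLsA hNA h1A
  refine directionalGC_le_of_cross_variational ωP ωA t t'A UA μA t'P UP μP nP nA ?_ ?_
  · rw [eP]
    have h := hμP nA hnA0.le hnA2
    linarith
  · rw [eA]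
    have h := hμA nP hnP0.le hnP2
    linarith

end InfVolFermionState

/-! ### §7 The covering rule: a word certified cell by cell holds on every box the cells cover -/

section Cover

variable {X ι : Type*}

/-- **Ceilings over a cover.** If `B ⊆ ⋃_{i ∈ s} C i` and `f ≤ x i` on each cell `C i`, then
`f ≤ max_i x i` on `B`. (The certified-box bookkeeping: a material box covered by finitely many certified
cells carries the worst cell constant.) [folklore] -/
private theorem le_sup'_of_cover {s : Finset ι} (hs : s.Nonempty) {C : ι → Set X} {B : Set X}
    (hB : B ⊆ ⋃ i ∈ s, C i) {f : X → ℝ} {x : ι → ℝ} (h : ∀ i ∈ s, ∀ θ ∈ C i, f θ ≤ x i)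
    {θ : X} (hθ : θ ∈ B) : f θ ≤ s.sup' hs x := by
  obtain ⟨i, hi, hθi⟩ := Set.mem_iUnion₂.1 (hB hθ)
  exact (h i hi θ hθi).trans (Finset.le_sup' x hi)

/-- **Floors over a cover**: `B ⊆ ⋃_{i ∈ s} C i` and `x i ≤ f` on each `C i` give `min_i x i ≤ f` on `B`.
[folklore] -/
private theorem inf'_le_of_cover {s : Finset ι} (hs : s.Nonempty) {C : ι → Set X} {B : Set X}
    (hB : B ⊆ ⋃ i ∈ s, C i) {f : X → ℝ} {x : ι → ℝ} (h : ∀ i ∈ s, ∀ θ ∈ C i, x i ≤ f θ)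
    {θ : X} (hθ : θ ∈ B) : s.inf' hs x ≤ f θ := by
  obtain ⟨i, hi, hθi⟩ := Set.mem_iUnion₂.1 (hB hθ)
  exact (Finset.inf'_le x hi).trans (h i hi θ hθi)

/-- **Two-sided words over a cover**: cell-wise windows `lo i ≤ f ≤ hi i` on `C i` give the window
`[min_i lo i, max_i hi i]` on every `B ⊆ ⋃_{i ∈ s} C i`. [folklore] -/
private theorem mem_Icc_of_cover {s : Finset ι} (hs : s.Nonempty) {C : ι → Set X} {B : Set X}
    (hB : B ⊆ ⋃ i ∈ s, C i) {f : X → ℝ} {lo hi : ι → ℝ}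
    (h : ∀ i ∈ s, ∀ θ ∈ C i, lo i ≤ f θ ∧ f θ ≤ hi i) {θ : X} (hθ : θ ∈ B) :
    f θ ∈ Set.Icc (s.inf' hs lo) (s.sup' hs hi) :=
  ⟨inf'_le_of_cover hs hB (fun i hi' θ' hθ' => (h i hi' θ' hθ').1) hθ,
    le_sup'_of_cover hs hB (fun i hi' θ' hθ' => (h i hi' θ' hθ').2) hθ⟩

end Cover

namespace ThermodynamicLimit

/-- An affine function of the density takes its least value over `[n₁, n₂]` at an endpoint:
`min (c + μ n₁) (c + μ n₂) ≤ c + μ n` for `n ∈ [n₁, n₂]`. [folklore] -/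
private theorem min_affine_endpoints_le {c μ n₁ n₂ n : ℝ} (h₁ : n₁ ≤ n) (h₂ : n ≤ n₂) :
    min (c + μ * n₁) (c + μ * n₂) ≤ c + μ * n := by
  rcases le_total 0 μ with hμ | hμ
  · exact (min_le_left _ _).trans (by nlinarith)
  · exact (min_le_right _ _).trans (by nlinarith)

/-- **Covering rule for energy words** ("box ⊂ union of certified cells ⇒ one word"). Parameter points
`θ = (t', U, n)`; cells `C k ⊆ ℝ³` (`k ∈ s`) each carrying a certified two-sided energy word
`lo k ≤ e(t, θ) ≤ hi k` for every `θ ∈ C k` (e.g. the box/triangle/chord/plane words of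
`HubbardNNNHoppingEnergyDensityRegionBounds` and of this file); then every set `B ⊆ ⋃_{k ∈ s} C k` — a
material box — carries the word `min_k lo k ≤ e(t, θ) ≤ max_k hi k`. [cite: Israel1979, Thm. I.3.4] -/
theorem energyDensityTT'_mem_Icc_of_cover (t : ℝ) {ι : Type*} {s : Finset ι} (hs : s.Nonempty)
    {C : ι → Set (ℝ × ℝ × ℝ)} {B : Set (ℝ × ℝ × ℝ)} (hB : B ⊆ ⋃ k ∈ s, C k) {lo hi : ι → ℝ}
    (h : ∀ k ∈ s, ∀ θ ∈ C k, lo k ≤ energyDensityTT' t θ.1 θ.2.1 θ.2.2 ∧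
      energyDensityTT' t θ.1 θ.2.1 θ.2.2 ≤ hi k)
    {θ : ℝ × ℝ × ℝ} (hθ : θ ∈ B) :
    energyDensityTT' t θ.1 θ.2.1 θ.2.2 ∈ Set.Icc (s.inf' hs lo) (s.sup' hs hi) :=
  mem_Icc_of_cover hs hB (f := fun θ : ℝ × ℝ × ℝ => energyDensityTT' t θ.1 θ.2.1 θ.2.2) h hθ

/-- **Covering rule, floors only**: cell-wise floors `lo k ≤ e(t, θ)` on `C k` give `min_k lo k ≤ e(t, θ)` on
every `B ⊆ ⋃_{k ∈ s} C k`. [cite: Israel1979, Thm. I.3.4] -/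
theorem energyDensityTT'_ge_inf'_of_cover (t : ℝ) {ι : Type*} {s : Finset ι} (hs : s.Nonempty)
    {C : ι → Set (ℝ × ℝ × ℝ)} {B : Set (ℝ × ℝ × ℝ)} (hB : B ⊆ ⋃ k ∈ s, C k) {lo : ι → ℝ}
    (h : ∀ k ∈ s, ∀ θ ∈ C k, lo k ≤ energyDensityTT' t θ.1 θ.2.1 θ.2.2)
    {θ : ℝ × ℝ × ℝ} (hθ : θ ∈ B) : s.inf' hs lo ≤ energyDensityTT' t θ.1 θ.2.1 θ.2.2 :=
  inf'_le_of_cover hs hB (f := fun θ : ℝ × ℝ × ℝ => energyDensityTT' t θ.1 θ.2.1 θ.2.2) h hθ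

/-- **Covering rule, ceilings only**: cell-wise ceilings `e(t, θ) ≤ hi k` on `C k` give
`e(t, θ) ≤ max_k hi k` on every `B ⊆ ⋃_{k ∈ s} C k`. [cite: Israel1979, Thm. I.3.4] -/
theorem energyDensityTT'_le_sup'_of_cover (t : ℝ) {ι : Type*} {s : Finset ι} (hs : s.Nonempty)
    {C : ι → Set (ℝ × ℝ × ℝ)} {B : Set (ℝ × ℝ × ℝ)} (hB : B ⊆ ⋃ k ∈ s, C k) {hi : ι → ℝ}
    (h : ∀ k ∈ s, ∀ θ ∈ C k, energyDensityTT' t θ.1 θ.2.1 θ.2.2 ≤ hi k)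
    {θ : ℝ × ℝ × ℝ} (hθ : θ ∈ B) : energyDensityTT' t θ.1 θ.2.1 θ.2.2 ≤ s.sup' hs hi :=
  le_sup'_of_cover hs hB (f := fun θ : ℝ × ℝ × ℝ => energyDensityTT' t θ.1 θ.2.1 θ.2.2) h hθ

/-- **Energy floor of a product box from a cover by `μ`-cells** ("box ⊂ union of certified cells ⇒ one
word"). Let the `(t', U)`-shadow `R` of a material box be covered by finitely many cells `C k`
(`R ⊆ ⋃_{k ∈ s} C k`), each carrying a CELL-WIDE `μ`-floor: `c k + μ k · m ≤ e(t, s', U', m)` for every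
`(s', U') ∈ C k` and every `0 ≤ m < 2` (e.g. the rectangle forms of `HubbardTTPrimeChemicalPotentialFloors`
§2 with the min taken over the corners). Then at every `(s', U') ∈ R` and every density `n ∈ [n₁, n₂] ⊆ [0, 2)`:
`min over k of min (c k + μ k n₁) (c k + μ k n₂) ≤ e(t, s', U', n)` — one certified floor for the whole box
`R × [n₁, n₂]`. [cite: Israel1979, Thm. I.3.4] -/
theorem energyDensityTT'_ge_inf'_of_gcFloor_cover (t : ℝ) {ι : Type*} {s : Finset ι} (hs : s.Nonempty)
    {C : ι → Set (ℝ × ℝ)} {R : Set (ℝ × ℝ)} (hR : R ⊆ ⋃ k ∈ s, C k) (c μ : ι → ℝ)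
    (hc : ∀ k ∈ s, ∀ p ∈ C k, ∀ m : ℝ, 0 ≤ m → m < 2 → c k + μ k * m ≤ energyDensityTT' t p.1 p.2 m)
    {n₁ n₂ : ℝ} (hn₁ : 0 ≤ n₁) (hn₂ : n₂ < 2) {p : ℝ × ℝ} (hp : p ∈ R) {n : ℝ} (h₁ : n₁ ≤ n)
    (h₂ : n ≤ n₂) :
    s.inf' hs (fun k => min (c k + μ k * n₁) (c k + μ k * n₂)) ≤ energyDensityTT' t p.1 p.2 n :=
  inf'_le_of_cover hs hR (f := fun q : ℝ × ℝ => energyDensityTT' t q.1 q.2 n)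
    (fun k hk q hq => (min_affine_endpoints_le h₁ h₂).trans
      (hc k hk q hq n (hn₁.trans h₁) (h₂.trans_lt hn₂))) hp

end ThermodynamicLimit

end Literature.MathematicalPhysics.QuantumLattice

end
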